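import Literature.MathematicalPhysics.QuantumFieldTheory.Balaban1983to89.B9Thm312WholeLeft
import Literature.MathematicalPhysics.QuantumFieldTheory.Balaban1983to89.B9RWSums346Schur

/-!
# `Balaban1983to89.B9Thm312WholeL2` — [B9] Theorem 3.12 (p. 423): the six BLOCK-L² ENTRIES (3.46) of the Sect.-D propagators G, G₁ at
# one member and one configuration — n = 0, 1, 2 by the Schur test from the proved sup majorants, n = 3, 4, 5 by r1's block-L² Neumann
# bookkeeping from Theorem 3.3 for G₀ and the perturbation step in the L² classes (schemas of printed shape)

T. Bałaban, *Propagators for lattice gauge theories in a background field*, Commun. Math. Phys. **99** (1985) 389–434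
[`Balaban1985BackgroundPropagators`, "B9"]; [4] = T. Bałaban, *Propagators and renormalization transformations for lattice
gauge theories. II*, Commun. Math. Phys. **96** (1984) 223–250 [`Balaban1984PropagatorsII`].

statement-level skeleton of published theorems with citation tags; proofs where landed; nothing here is a claim about the
Yang–Mills mass gap

THE PRINTED LOCI (verbatim).  (3.46) p. 398: *"Finally, we have the inequalities in L²-norms ‖hG′(U)λ‖, ‖h∇_UG′(U)λ‖, ‖hG′(U)∇\*_Uλ‖,
‖hΔ_UG′(U)λ‖, ‖h∇_UG′(U)∇\*_Uλ‖, ‖hG′(U)Δ_Uλ‖ ≦ B₀[(Lʲη)², Lʲη, Lʲη, 1, 1, 1]|h|e^{−δ₀d(y,y′)}‖λ‖ for supp h ⊂ Δ(y), y ∈ Λ_j, supp λ ⊂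
Δ(y′)"*; p. 398: *"At first the choice of derivatives ∇_U, ∇\*_U is conventional, we may always replace ∇_U by ∇\*_U, and vice versa … the
choice of powers Lʲη is conventional also. Using Lemma 2.1 in [4] we may replace the factor (Lʲη)^α by (Lʲη)^β(L^{j′}η)^γ with β + γ = α"*;
Theorem 3.3 p. 399; (3.130) p. 421; p. 422: *"This inequality [(3.131)] and Theorem 3.3 for G₀ imply a convergence of the series (3.130),
for α₀ sufficiently small, in all norms appearing on the left-hand sides of the inequalities (3.42)–(3.47), except the inequality involving
the Laplace operator in (3.42)"*; Theorem 3.12 p. 423: *"… The exception is the inequality in (3.42) involving the covariant Laplace operator.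
It does not hold for G, G₁."* (so the L² Laplacian lines (3.46)₃,₅ ARE asserted for G, G₁); Theorem 3.11 p. 416 (G symmetric).

THE POINT.  The typed leaf `B9.Thm312Printed` asks, for K ∈ [G_D, G₁], the whole L² block of `Ineq342_346_347_noLap`: all six lines
(3.46)ₙ.  Seat n06-l's row-20∕21 leaves display them (`hres`).  THIS FILE produces, at one member and one U, the six BLOCK-L² BOUNDS
(`B9SectDL2Decay.BlockBd`, r1) of the model operators A, ∇_UA, A∇\*_U, Δ_UA, ∇_UA∇\*_U, AΔ_U (A ∈ {G, G₁}) in the printed shapes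
B·pref6(Lʲη)ₙ·e^{−ρd} — the inputs `hT` of n06-k's `B9RWSumsReadsRel.l2line_of_blockBd_rel`:
* §1 lines n = 0, 1, 2 — NO NEW HYPOTHESIS about G₀ or Δ′_π: the Schur test (n06-k `B9RWSums346Schur.blockBd_schur`) applied to the PROVED
  sup majorants of A, ∇_UA, A∇\*_U (`B9Thm312WholeLeaf.entry0_of_step`, `B9Thm312WholeLeft.entry1_of_stepD`, `…Leaf.entry2_of_step`) with the
  symmetry of A and the transpose pair (∇_UA, A∇\*_U) (p. 391 ∕ Thm 3.11; letters `IsTransposePair`), then p. 398's scale transfer as a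
  HYPOTHESIS `B9Ineq347.ScaleTransfer g ρ α Λ (Lʲη)^γ` (γ = 1, ½; [4] (2.60), supplied at the record by `…Classes.scaleTransfer_rpow_of_260`):
  `blockBd_transfer` (ratio form), ★ `l2bd_entry0_of_sup`, ★ `l2bd_entry12_of_sup`.
* §2 lines n = 3, 4, 5 — the covariant Laplacian Δ_U as an extra LETTER `Lap : B.Cfg → Module.End ℝ (X → ℝ)` (a parameter, not a field
  of `Ops`), and two HYPOTHESIS SCHEMAS of printed shape (nothing asserted): `Thm33G0L2` = THEOREM 3.3 (3.46) FOR G₀ as block-L² bounds in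
  r1's weight classes (the scale factors split between y and y′ per p. 398: (3.46)₀ symmetrised B·Lʲη·L^{j′}η, (3.46)₁ at the input
  scale, (3.46)₃,₅ with the dimensionless ratio L^{j′}η∕Lʲη), `StepL2` = THE PERTURBATION STEP IN THE L² CLASS: Δ′_π (and Δ′_π + Δ⁽²⁾_π)
  with the block-L² bound θ·(Lʲη)⁻¹(L^{j′}η)⁻¹e^{−δ₁d} (r1-g6's printed shape, its md `SectD-L2-decay-proof.md` §4; located gap
  C-r1g6-1); then ★ `l2bd_entry4_of_step`, ★ `l2bd_entry3_of_step`, ★ `l2bd_entry5_of_step` = r1-g6's KERNEL-CHECKED Neumann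
  bookkeeping `B9SectDL2Decay.thm312_entry_l2` instantiated in the three classes (+ one scale transfer for n = 3, 5), smallness
  q_{L²} = Bθc² < 1 (*"for α₀ sufficiently small"*).
The family leaves consuming §1–§2 are the sequels `…B9Thm312WholeLeafAll` ∕ `…B9Thm313WholeLeafAll`.

HONEST SCOPE.  Nothing of [B9] or [4] is asserted: the sup majorants enter as hypotheses (proved upstream from the sup-class schemas),
Theorem 3.3 (3.46) for G₀, Δ′_π's block-L² bound, the transposition letters and (2.60) are HYPOTHESES of printed shape; the content is
Schur's test + r1's Neumann bookkeeping + the scale transfer, kernel-checked.  NOT a node discharge, NOT summit progress; one finite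
lattice at a time; nothing continuum, nothing about the mass gap.  Cell `pub-ymgap` (HUMAN RULING D-0062), Track A node N06 [B9],
N06-ASSIGNMENT v1 rows 20–21 (bundle F7), seat `pub-ymgap-dag-n06-l` (g4), 2026-08-27.
-/

namespace Literature.MathematicalPhysics.QuantumFieldTheory.Balaban1983to89.B9Thm312WholeL2

open Literature.MathematicalPhysics.QuantumFieldTheory.Balaban1983to89
open Finset B6RandomWalk B6RandomWalkHom B9Thm34Ext B9Thm37Glue B9Thm37GlueCor36 B11SectG B9SectDSup B9SectDL2Decay
open B9Thm37AllNorms B9Thm37AllNormsInstances B9Thm312Whole B9Thm312WholeLeaf B9Thm312WholeLeft B9RWSums346Schur B9Ineq347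

noncomputable section

/-! ## §1 The lines n = 0, 1, 2 of (3.46) by the Schur test from the sup majorants -/

section Schur

variable {g : B9.Geometry} {X Y V : Type} [Fintype X] [Fintype Y] [Fintype V] [Fintype g.Site]
variable {R₀ : ℝ} {H₀ : Prop}

/-- **p. 398's scale transfer applied to a block-L² bound, ratio form**: a block bound C·(w(y′)∕w(y))·e^{−ρd} becomes C·Λ·e^{−(ρ−αρ₀)d}
whenever e^{−αρ₀d(y,y′)}w(y′) ≦ Λw(y) (`B9Ineq347.ScaleTransfer`, from [4] (2.60)) and w > 0 — the companion of r1's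
`B9SectDL2Decay.BlockBd.transfer` over an abstract weight. [cite: Balaban1985BackgroundPropagators, p.398 (remark after (3.47)); Balaban1984PropagatorsII, Lemma 2.1 (2.60) p.234] -/
theorem blockBd_transfer {blkV : V → g.Site} {blk : X → g.Site} {T : (V → ℝ) →ₗ[ℝ] (X → ℝ)} {w : g.Site → ℝ}
    {C : g.Site → g.Site → ℝ} {ρ ρ₀ α Λ : ℝ} (hC : ∀ y y', 0 ≤ C y y') (hw : ∀ y, 0 < w y) (hST : ScaleTransfer g ρ₀ α Λ w)
    (h : BlockBd (g := toB6 g R₀ H₀) blkV blk T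
      (fun (y y' : g.Site) => C y y' * (w y' * (w y)⁻¹) * Real.exp (-(ρ * g.dist y y')))) :
    BlockBd (g := toB6 g R₀ H₀) blkV blk T (fun (y y' : g.Site) => C y y' * Λ * Real.exp (-((ρ - α * ρ₀) * g.dist y y'))) := by
  refine h.mono fun y y' => ?_
  have hwy : 0 < w y := hw y
  have hst : Real.exp (-(α * ρ₀ * g.dist y y')) * w y' ≤ Λ * w y := hST y y'
  have hratio : w y' * (w y)⁻¹ * Real.exp (-(α * ρ₀ * g.dist y y')) ≤ Λ := by
    rw [mul_comm, ← mul_assoc, ← div_eq_mul_inv, div_le_iff₀ hwy]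
    exact hst
  have hsplit : Real.exp (-(ρ * g.dist y y')) =
      Real.exp (-(α * ρ₀ * g.dist y y')) * Real.exp (-((ρ - α * ρ₀) * g.dist y y')) := by
    rw [← Real.exp_add]; congr 1; ring
  rw [hsplit]
  calc C y y' * (w y' * (w y)⁻¹) * (Real.exp (-(α * ρ₀ * g.dist y y')) * Real.exp (-((ρ - α * ρ₀) * g.dist y y')))
      = C y y' * (w y' * (w y)⁻¹ * Real.exp (-(α * ρ₀ * g.dist y y'))) * Real.exp (-((ρ - α * ρ₀) * g.dist y y')) := by ring
    _ ≤ C y y' * Λ * Real.exp (-((ρ - α * ρ₀) * g.dist y y')) :=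
        mul_le_mul_of_nonneg_right (mul_le_mul_of_nonneg_left hratio (hC y y')) (Real.exp_nonneg _)

omit [Fintype Y] [Fintype V] in
/-- ★ **(3.46)₀ FOR A ∈ {G, G₁} AS A BLOCK-L² BOUND, from the proved sup majorant (3.42)₁ and the symmetry of A**: by the Schur test
(row bound at y, column bound = row bound at y′, `B9RWSums346Schur.blockBd_schur`) ‖1_{Δ(y)}Aμ‖₂ ≦ C·Lʲη·L^{j′}η·e^{−ρd}‖μ‖₂, and by the
scale transfer of the weight L^{j′}η (γ = 1, constant Λ) ‖1_{Δ(y)}Aμ‖₂ ≦ CΛ(Lʲη)²e^{−(1−α)ρd(y,y′)}‖μ‖₂ for supp μ ⊂ Δ(y′) (n06-k's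
`blockBd_entry0` with the member facts unbundled). [cite: Balaban1985BackgroundPropagators, (3.46) p.398 + (3.42) p.397 + Thm 3.11 p.416 + p.398; Balaban1984PropagatorsII, (2.60) p.234] -/
theorem l2bd_entry0_of_sup (hG : GeoOK g) {blk : X → g.Site} {A0 : Module.End ℝ (X → ℝ)} {C ρ α Λ : ℝ} (hC : 0 ≤ C)
    (hST : ScaleTransfer g ρ α Λ (fun y => g.len y ^ (1 : ℝ)))
    (h0 : HasMajorant (g := toB6 g R₀ H₀) blk A0 (fun (a b : g.Site) => C * g.len a ^ 2 * Real.exp (-(ρ * g.dist a b))))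
    (hsym : IsTransposePair A0 A0) :
    BlockBd (g := toB6 g R₀ H₀) blk blk A0
      (fun (y y' : g.Site) => C * Λ * g.len y ^ 2 * Real.exp (-((1 - α) * ρ * g.dist y y'))) := by
  -- adapted from n06-k's `B9RWSums346Schur.blockBd_entry0`
  have hK : ∀ a b : g.Site, 0 ≤ C * g.len a ^ 2 * Real.exp (-(ρ * g.dist a b)) := fun a b =>
    mul_nonneg (mul_nonneg hC (sq_nonneg _)) (Real.exp_nonneg _)
  have h0' : HasMajorantHom (g := toB6 g R₀ H₀) blk blk A0 (fun (a b : g.Site) => C * g.len a ^ 2 * Real.exp (-(ρ * g.dist a b))) :=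
    (hasMajorantHom_iff (g := toB6 g R₀ H₀) blk A0 _).mpr h0
  have hS := blockBd_schur (G := toB6 g R₀ H₀) blk blk hK hK h0' h0' hsym
  -- √(C(Lʲη)²e^{−ρd} · C(L^{j′}η)²e^{−ρd}) = C·Lʲη·L^{j′}η·e^{−ρd}, written in the ratio form of `blockBd_transfer`
  have hS' : BlockBd (g := toB6 g R₀ H₀) blk blk A0
      (fun (y y' : g.Site) => (C * g.len y ^ 2) * (g.len y' ^ (1 : ℝ) * (g.len y ^ (1 : ℝ))⁻¹) * Real.exp (-(ρ * g.dist y y'))) := by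
    refine hS.mono fun y y' => le_of_eq ?_
    have hsq : (C * g.len y ^ 2 * Real.exp (-(ρ * g.dist y y'))) * (C * g.len y' ^ 2 * Real.exp (-(ρ * g.dist y' y))) =
        (C * g.len y * g.len y' * Real.exp (-(ρ * g.dist y y'))) ^ 2 := by
      rw [hG.symm y' y]; ring
    have hnn : 0 ≤ C * g.len y * g.len y' * Real.exp (-(ρ * g.dist y y')) :=
      mul_nonneg (mul_nonneg (mul_nonneg hC (hG.lenle y)) (hG.lenle y')) (Real.exp_nonneg _)
    have hy : g.len y ≠ 0 := (hG.lenpos y).ne'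
    show Real.sqrt ((C * g.len y ^ 2 * Real.exp (-(ρ * g.dist y y'))) * (C * g.len y' ^ 2 * Real.exp (-(ρ * g.dist y' y)))) =
      (C * g.len y ^ 2) * (g.len y' ^ (1 : ℝ) * (g.len y ^ (1 : ℝ))⁻¹) * Real.exp (-(ρ * g.dist y y'))
    rw [hsq, Real.sqrt_sq hnn]
    simp only [Real.rpow_one]
    rw [show C * g.len y ^ 2 * (g.len y' * (g.len y)⁻¹) * Real.exp (-(ρ * g.dist y y')) =
        C * g.len y * g.len y' * Real.exp (-(ρ * g.dist y y')) * (g.len y * (g.len y)⁻¹) by ring, mul_inv_cancel₀ hy, mul_one]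
  -- the transfer of the ratio L^{j′}η ∕ Lʲη
  have hT := blockBd_transfer (C := fun y _ => C * g.len y ^ 2) (fun y _ => mul_nonneg hC (sq_nonneg _))
    (fun z => Real.rpow_pos_of_pos (hG.lenpos z) 1) hST hS'
  refine hT.mono fun y y' => le_of_eq ?_
  rw [show ρ - α * ρ = (1 - α) * ρ by ring]
  ring

omit [Fintype V] [Fintype g.Site] in
/-- The common computation of the two mixed lines: √(C·Lʲη·e^{−ρd(y,y′)} · C·L^{j′}η·e^{−ρd(y′,y)}) = C(Lʲη)^{½}(L^{j′}η)^{½}e^{−ρd}, and the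
transfer of (L^{j′}η)^{½} at γ = ½ (constant Λ) gives ≦ CΛ·Lʲη·e^{−(1−α)ρd(y,y′)}. [cite: Balaban1985BackgroundPropagators, p.398 (remark after (3.47)); Balaban1984PropagatorsII, (2.60) p.234] -/
theorem sqrt_mixed_le_of_transfer (hG : GeoOK g) {C ρ α Λ : ℝ} (hC : 0 ≤ C)
    (hST : ScaleTransfer g ρ α Λ (fun y => g.len y ^ (1 / 2 : ℝ))) (y y' : g.Site) :
    Real.sqrt ((C * g.len y * Real.exp (-(ρ * g.dist y y'))) * (C * g.len y' * Real.exp (-(ρ * g.dist y' y)))) ≤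
      C * Λ * g.len y * Real.exp (-((1 - α) * ρ * g.dist y y')) := by
  -- adapted from n06-k's `B9RWSums346Schur.sqrt_mixed_le`
  have hlen0 : ∀ z : g.Site, 0 ≤ g.len z := hG.lenle
  have hhalf : ∀ z : g.Site, g.len z = (g.len z ^ (1 / 2 : ℝ)) ^ 2 := fun z => by
    rw [← Real.rpow_natCast, ← Real.rpow_mul (hlen0 z)]; norm_num
  have hsq : (C * g.len y * Real.exp (-(ρ * g.dist y y'))) * (C * g.len y' * Real.exp (-(ρ * g.dist y' y))) =
      (C * g.len y ^ (1 / 2 : ℝ) * g.len y' ^ (1 / 2 : ℝ) * Real.exp (-(ρ * g.dist y y'))) ^ 2 := by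
    rw [hG.symm y' y]
    conv_lhs => rw [hhalf y, hhalf y']
    ring
  have hnn : 0 ≤ C * g.len y ^ (1 / 2 : ℝ) * g.len y' ^ (1 / 2 : ℝ) * Real.exp (-(ρ * g.dist y y')) :=
    mul_nonneg (mul_nonneg (mul_nonneg hC (Real.rpow_nonneg (hlen0 y) _)) (Real.rpow_nonneg (hlen0 y') _))
      (Real.exp_nonneg _)
  rw [hsq, Real.sqrt_sq hnn]
  have hst : Real.exp (-(α * ρ * g.dist y y')) * g.len y' ^ (1 / 2 : ℝ) ≤ Λ * g.len y ^ (1 / 2 : ℝ) := hST y y'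
  have hsplit : Real.exp (-(ρ * g.dist y y')) =
      Real.exp (-(α * ρ * g.dist y y')) * Real.exp (-((1 - α) * ρ * g.dist y y')) := by
    rw [← Real.exp_add]; congr 1; ring
  have hyy : g.len y ^ (1 / 2 : ℝ) * g.len y ^ (1 / 2 : ℝ) = g.len y := by
    rw [← sq]; exact (hhalf y).symm
  have hCy : 0 ≤ C * g.len y ^ (1 / 2 : ℝ) := mul_nonneg hC (Real.rpow_nonneg (hlen0 y) _)
  rw [hsplit]
  calc C * g.len y ^ (1 / 2 : ℝ) * g.len y' ^ (1 / 2 : ℝ) *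
        (Real.exp (-(α * ρ * g.dist y y')) * Real.exp (-((1 - α) * ρ * g.dist y y')))
      = C * g.len y ^ (1 / 2 : ℝ) * (Real.exp (-(α * ρ * g.dist y y')) * g.len y' ^ (1 / 2 : ℝ)) *
          Real.exp (-((1 - α) * ρ * g.dist y y')) := by ring
    _ ≤ C * g.len y ^ (1 / 2 : ℝ) * (Λ * g.len y ^ (1 / 2 : ℝ)) * Real.exp (-((1 - α) * ρ * g.dist y y')) :=
        mul_le_mul_of_nonneg_right (mul_le_mul_of_nonneg_left hst hCy) (Real.exp_nonneg _)
    _ = C * Λ * (g.len y ^ (1 / 2 : ℝ) * g.len y ^ (1 / 2 : ℝ)) * Real.exp (-((1 - α) * ρ * g.dist y y')) := by ring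
    _ = C * Λ * g.len y * Real.exp (-((1 - α) * ρ * g.dist y y')) := by rw [hyy]

omit [Fintype V] in
/-- ★ **(3.46)₁ AND (3.46)₂ FOR A ∈ {G, G₁} AS BLOCK-L² BOUNDS, from the proved sup majorants (3.42)₂, (3.42)₃ and the transposition (∇_UA)ᵀ =
A∇\*_U** (p. 398 *"we may always replace ∇_U by ∇\*_U, and vice versa"*, p. 391 the L² adjoints; letter `IsTransposePair A₁ A₂`): by the Schur test
and the transfer at γ = ½, ‖1_{Δ(y)}A₁μ‖₂, ‖1_{Δ(y)}A₂μ‖₂ ≦ CΛ·Lʲη·e^{−(1−α)ρd(y,y′)}‖μ‖₂ for supp μ ⊂ Δ(y′) (n06-k's `blockBd_entry1∕2` with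
the member facts unbundled). [cite: Balaban1985BackgroundPropagators, (3.46) p.398 + (3.42) p.397 + p.391; Balaban1984PropagatorsII, (2.60) p.234] -/
theorem l2bd_entry12_of_sup (hG : GeoOK g) {blk : X → g.Site} {blkY : Y → g.Site} {A1 : (X → ℝ) →ₗ[ℝ] (Y → ℝ)}
    {A2 : (Y → ℝ) →ₗ[ℝ] (X → ℝ)} {C ρ α Λ : ℝ} (hC : 0 ≤ C) (hST : ScaleTransfer g ρ α Λ (fun y => g.len y ^ (1 / 2 : ℝ)))
    (h1 : HasMajorantHom (g := toB6 g R₀ H₀) blk blkY A1 (fun (a b : g.Site) => C * g.len a * Real.exp (-(ρ * g.dist a b))))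
    (h2 : HasMajorantHom (g := toB6 g R₀ H₀) blkY blk A2 (fun (a b : g.Site) => C * g.len a * Real.exp (-(ρ * g.dist a b))))
    (htr : IsTransposePair A1 A2) :
    BlockBd (g := toB6 g R₀ H₀) blk blkY A1 (fun (y y' : g.Site) => C * Λ * g.len y * Real.exp (-((1 - α) * ρ * g.dist y y'))) ∧
      BlockBd (g := toB6 g R₀ H₀) blkY blk A2 (fun (y y' : g.Site) => C * Λ * g.len y * Real.exp (-((1 - α) * ρ * g.dist y y'))) := by
  have hK : ∀ a b : g.Site, 0 ≤ C * g.len a * Real.exp (-(ρ * g.dist a b)) := fun a b =>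
    mul_nonneg (mul_nonneg hC (hG.lenle a)) (Real.exp_nonneg _)
  exact ⟨(blockBd_schur (G := toB6 g R₀ H₀) blk blkY hK hK h1 h2 htr).mono fun y y' => sqrt_mixed_le_of_transfer hG hC hST y y',
    (blockBd_schur (G := toB6 g R₀ H₀) blkY blk hK hK h2 h1 htr.symm).mono fun y y' => sqrt_mixed_le_of_transfer hG hC hST y y'⟩

end Schur

/-! ## §2 The lines n = 3, 4, 5 of (3.46): Theorem 3.3 for G₀ and the step in the L² classes, and r1's Neumann bookkeeping -/

section L2Classes

variable {g : B9.Geometry} {B : B9.Backgrounds} {X Y Z W : Type} [Fintype X] [Fintype Y] [Fintype g.Site]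
variable {R₀ : ℝ} {H₀ : Prop}

/-- **THEOREM 3.3, THE L² MEMBERS (3.46), FOR G₀ AT THE CONFIGURATION U AS BLOCK-L² BOUNDS** (p. 399: G₀ = G(U) *"satisfies the
inequalities (3.42)–(3.47)"*; (3.46) p. 398), in r1-g6's weight classes — the printed one-sided scale powers [(Lʲη)², Lʲη, Lʲη, 1, 1, 1]
split between the output block y and the input block y′ as p. 398 allows (*"we may replace the factor (Lʲη)^α by (Lʲη)^β(L^{j′}η)^γ with β +
γ = α"*): `l0` — ‖1_{Δ(y)}G₀μ‖₂ ≦ B·Lʲη·L^{j′}η·e^{−δ₁d}‖μ‖₂ ((3.46)₀ symmetrised; G₀ symmetric, r1-g6 `blockBd_symm`∕`blockBd_geom`); `l1` —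
∇_UG₀ with B·L^{j′}η ((3.46)₁ at the input scale); `l2` — G₀∇\*_U with B·Lʲη ((3.46)₂ verbatim); `l3` — Δ_UG₀ with B·(L^{j′}η∕Lʲη) and `l5` —
G₀Δ_U with B·(Lʲη∕L^{j′}η) ((3.46)₃,₅: printed constant 1, times the dimensionless scale ratio); `l4` — ∇_UG₀∇\*_U with B ((3.46)₄ verbatim).
`Lap U` = the covariant Laplacian Δ_U (a LETTER).  A HYPOTHESIS SCHEMA (Theorem 3.3 is the leaf `t33` of the knit, not asserted here).
[cite: Balaban1985BackgroundPropagators, Thm 3.3 p.399 + (3.46) p.398 + p.398 (remark after (3.47))] -/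
structure Thm33G0L2 (𝔬 : Ops g B X Y Z W) (Lap : B.Cfg → Module.End ℝ (X → ℝ)) (R₀ : ℝ) (H₀ : Prop) (B₂ δ₁ : ℝ) (U : B.Cfg) :
    Prop where
  l0 : BlockBd (g := toB6 g R₀ H₀) 𝔬.blk 𝔬.blk (𝔬.G0 U)
    (fun (y y' : g.Site) => B₂ * g.len y * g.len y' * Real.exp (-(δ₁ * g.dist y y')))
  l1 : BlockBd (g := toB6 g R₀ H₀) 𝔬.blk 𝔬.blkY (𝔬.D U ∘ₗ 𝔬.G0 U)
    (fun (y y' : g.Site) => B₂ * g.len y' * Real.exp (-(δ₁ * g.dist y y')))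
  l2 : BlockBd (g := toB6 g R₀ H₀) 𝔬.blkY 𝔬.blk (𝔬.G0 U ∘ₗ 𝔬.Dstar U)
    (fun (y y' : g.Site) => B₂ * g.len y * Real.exp (-(δ₁ * g.dist y y')))
  l3 : BlockBd (g := toB6 g R₀ H₀) 𝔬.blk 𝔬.blk (Lap U ∘ₗ 𝔬.G0 U)
    (fun (y y' : g.Site) => B₂ * ((g.len y)⁻¹ * g.len y') * Real.exp (-(δ₁ * g.dist y y')))
  l4 : BlockBd (g := toB6 g R₀ H₀) 𝔬.blkY 𝔬.blkY (𝔬.D U ∘ₗ (𝔬.G0 U ∘ₗ 𝔬.Dstar U))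
    (fun (y y' : g.Site) => B₂ * Real.exp (-(δ₁ * g.dist y y')))
  l5 : BlockBd (g := toB6 g R₀ H₀) 𝔬.blk 𝔬.blk (𝔬.G0 U ∘ₗ Lap U)
    (fun (y y' : g.Site) => B₂ * (g.len y * (g.len y')⁻¹) * Real.exp (-(δ₁ * g.dist y y')))

/-- **THE PERTURBATION STEP OF (3.130) ∕ (3.138) IN THE L² CLASS**: Δ′_π (`t`) and Δ′_π + Δ⁽²⁾_π (`t1`) have the block-L² bound
θ·(Lʲη)⁻¹(L^{j′}η)⁻¹·e^{−δ₁d(y,y′)} — r1-g6's printed shape for T′ in `B9SectDL2Decay.thm312_entry1_l2` (*"θ = O(1)Mα₀: (3.120), (3.36),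
Theorem 3.1, (3.49) — the cell md §4"*), the L² member of p. 422's *"This inequality [(3.131)] and Theorem 3.3 for G₀ imply a convergence of
the series (3.130), for α₀ sufficiently small, in all norms"*; its derivation is the located gap C-r1g6-1 ∕ G-B9-16 (declared, not typed).
A HYPOTHESIS SCHEMA; nothing asserted. [cite: Balaban1985BackgroundPropagators, (3.120) p.419 + (3.130)–(3.131) pp.421–422 + (3.135)–(3.138) pp.422–423] -/
structure StepL2 (𝔬 : Ops g B X Y Z W) (R₀ : ℝ) (H₀ : Prop) (θ δ₁ : ℝ) (U : B.Cfg) : Prop where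
  t : BlockBd (g := toB6 g R₀ H₀) 𝔬.blk 𝔬.blk (𝔬.Tpi U)
    (fun (y y' : g.Site) => θ * (g.len y)⁻¹ * (g.len y')⁻¹ * Real.exp (-(δ₁ * g.dist y y')))
  t1 : BlockBd (g := toB6 g R₀ H₀) 𝔬.blk 𝔬.blk (𝔬.Tpi U + 𝔬.T2 U)
    (fun (y y' : g.Site) => θ * (g.len y)⁻¹ * (g.len y')⁻¹ * Real.exp (-(δ₁ * g.dist y y')))

omit [Fintype X] [Fintype Y] [Fintype g.Site] in
/-- (3.130) in r1's product form G = G₀ + G₀T′G from the composition form of `B9Thm312WholeLeaf.fix_of_inverses`. [cite: Balaban1985BackgroundPropagators, (3.130) p.421 (bookkeeping)] -/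
theorem fix_mul_of_fix {G0 T A : Module.End ℝ (X → ℝ)} (hfix : A = G0 + G0 ∘ₗ T ∘ₗ A) : A = G0 + G0 * T * A := by
  rw [mul_assoc]; exact hfix

/-- ★ **(3.46)₄ FOR A ∈ {G, G₁} AS A BLOCK-L² BOUND** — ‖1_{Δ(y)}∇_UA∇\*_Uμ‖₂ ≦ K₄e^{−ρd}‖μ‖₂ for supp μ ⊂ Δ(y′) — by r1-g6's kernel-checked Neumann
bookkeeping `B9SectDL2Decay.thm312_entry_l2` (∇A∇\* = ∇G₀∇\* + (∇G₀)T′(A∇\*), A∇\* = G₀∇\* + (G₀T′)(A∇\*)) in the weight classes W₀ = W₃ = 1,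
W₁ = W₁′ = Lʲη, W₂ = (Lʲη)⁻¹, from Theorem 3.3 (3.46)₀,₁,₂,₄ for G₀ (`Thm33G0L2`), the step's L² bound (`StepL2`), the row sum (2.61) at rate σ
with ρ + 2σ ≦ δ₁ and the smallness B₂θc² < 1: K₄ = B₂ + B₂·θ·B₂(1 − B₂θc²)⁻¹·c².
[cite: Balaban1985BackgroundPropagators, Thm 3.12 p.423 + (3.46) p.398 + (3.130) p.421; Balaban1984PropagatorsII, Lemma 2.1 p.234] -/
theorem l2bd_entry4_of_step (hG : GeoOK g) {𝔬 : Ops g B X Y Z W} {Lap : B.Cfg → Module.End ℝ (X → ℝ)} {U : B.Cfg}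
    {T A : Module.End ℝ (X → ℝ)} {B₂ θ δ₁ ρ σ c : ℝ} (hrow : RowSum (toB6 g R₀ H₀) σ c)
    (hB₂ : 0 ≤ B₂) (hθ : 0 ≤ θ) (hρ : 0 ≤ ρ) (hσ : 0 ≤ σ) (hρδ : ρ + 2 * σ ≤ δ₁)
    (hL : Thm33G0L2 𝔬 Lap R₀ H₀ B₂ δ₁ U)
    (hT : BlockBd (g := toB6 g R₀ H₀) 𝔬.blk 𝔬.blk T
      (fun (y y' : g.Site) => θ * (g.len y)⁻¹ * (g.len y')⁻¹ * Real.exp (-(δ₁ * g.dist y y'))))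
    (hfix : A = 𝔬.G0 U + 𝔬.G0 U ∘ₗ T ∘ₗ A) (hq : B₂ * θ * c * c < 1) :
    BlockBd (g := toB6 g R₀ H₀) 𝔬.blkY 𝔬.blkY (𝔬.D U ∘ₗ (A ∘ₗ 𝔬.Dstar U))
      (fun (y y' : g.Site) => (B₂ + B₂ * (θ * (B₂ * (1 - B₂ * θ * c * c)⁻¹) * c) * c) * Real.exp (-(ρ * g.dist y y'))) := by
  have htri : Triangle254 (toB6 g R₀ H₀) := fun a b c => hG.tri a b c
  have hW1 : ∀ y : g.Site, 0 < (fun _ : g.Site => (1 : ℝ)) y := fun _ => one_pos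
  have hWl : ∀ y : g.Site, 0 < g.len y := hG.lenpos
  have hWi : ∀ y : g.Site, 0 < (g.len y)⁻¹ := fun y => inv_pos.mpr (hG.lenpos y)
  have hne : ∀ y : g.Site, g.len y ≠ 0 := fun y => (hG.lenpos y).ne'
  have h := thm312_entry_l2 (g := toB6 g R₀ H₀) (blk₀ := 𝔬.blkY) (blk := 𝔬.blk) (blk₃ := 𝔬.blkY)
    (W₀ := fun _ => (1 : ℝ)) (W₁ := fun y => g.len y) (W₂ := fun y => (g.len y)⁻¹) (W₁' := fun y => g.len y)
    (W₃ := fun _ => (1 : ℝ)) (G := A) (G0 := 𝔬.G0 U) (T' := T) (Eop := 𝔬.D U) (Fop := 𝔬.Dstar U)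
    (B := B₂) (θ := θ) (A := B₂) (θ' := θ) (BE := B₂) (AEF := B₂) hW1 hWl hWi hWl hW1 htri hG.dnn hrow hB₂ hθ hB₂ hθ hB₂ hB₂ hρ hσ
    hρδ
    (hL.l0.mono fun y y' => le_of_eq (by simp only [inv_inv, toB6_dist]; ring))
    (hT.mono fun y y' => le_of_eq (by simp only [toB6_dist]; ring))
    (hL.l2.mono fun y y' => le_of_eq (by simp only [inv_inv, toB6_dist]; ring))
    (hT.mono fun y y' => le_of_eq (by simp only [toB6_dist]; ring))
    (hL.l1.mono fun y y' => le_of_eq (by simp only [inv_one, toB6_dist]; ring))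
    (hL.l4.mono fun y y' => le_of_eq (by simp only [inv_one, toB6_dist]; ring))
    (fix_mul_of_fix hfix) hq
  refine h.mono fun y y' => le_of_eq ?_
  simp only [inv_one, one_mul, toB6_dist]

/-- ★ **(3.46)₃ FOR A ∈ {G, G₁} AS A BLOCK-L² BOUND** — ‖1_{Δ(y)}Δ_UAμ‖₂ ≦ K₃e^{−ρ′d}‖μ‖₂: `thm312_entry_l2` with the left letter Δ_U and the
right letter I in the classes W₀ = W₁ = W₁′ = W₃ = Lʲη, W₂ = (Lʲη)⁻¹ (from (3.46)₀,₃ for G₀ and the step), which yields the bound with the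
ratio L^{j′}η∕Lʲη, then the scale transfer of p. 398 (`blockBd_transfer`, [4] (2.60) at (ρ₀, α), constant Λ): K₃ = (B₂ + B₂θB₂(1 −
B₂θc²)⁻¹c²)·Λ at the rate ρ − αρ₀. [cite: Balaban1985BackgroundPropagators, Thm 3.12 p.423 + (3.46) p.398 + (3.130) p.421 + p.398; Balaban1984PropagatorsII, Lemma 2.1 p.234] -/
theorem l2bd_entry3_of_step (hG : GeoOK g) {𝔬 : Ops g B X Y Z W} {Lap : B.Cfg → Module.End ℝ (X → ℝ)} {U : B.Cfg}
    {T A : Module.End ℝ (X → ℝ)} {B₂ θ δ₁ ρ ρ₀ α Λ σ c : ℝ} (hrow : RowSum (toB6 g R₀ H₀) σ c)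
    (hB₂ : 0 ≤ B₂) (hθ : 0 ≤ θ) (hρ : 0 ≤ ρ) (hσ : 0 ≤ σ) (hρδ : ρ + 2 * σ ≤ δ₁)
    (hST : ScaleTransfer g ρ₀ α Λ (fun y => g.len y ^ (1 : ℝ)))
    (hL : Thm33G0L2 𝔬 Lap R₀ H₀ B₂ δ₁ U)
    (hT : BlockBd (g := toB6 g R₀ H₀) 𝔬.blk 𝔬.blk T
      (fun (y y' : g.Site) => θ * (g.len y)⁻¹ * (g.len y')⁻¹ * Real.exp (-(δ₁ * g.dist y y'))))
    (hfix : A = 𝔬.G0 U + 𝔬.G0 U ∘ₗ T ∘ₗ A) (hq : B₂ * θ * c * c < 1) :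
    BlockBd (g := toB6 g R₀ H₀) 𝔬.blk 𝔬.blk (Lap U ∘ₗ A)
      (fun (y y' : g.Site) => (B₂ + B₂ * (θ * (B₂ * (1 - B₂ * θ * c * c)⁻¹) * c) * c) * Λ *
        Real.exp (-((ρ - α * ρ₀) * g.dist y y'))) := by
  have htri : Triangle254 (toB6 g R₀ H₀) := fun a b c => hG.tri a b c
  have hWl : ∀ y : g.Site, 0 < g.len y := hG.lenpos
  have hWi : ∀ y : g.Site, 0 < (g.len y)⁻¹ := fun y => inv_pos.mpr (hG.lenpos y)
  have hq1 : 0 ≤ (1 - B₂ * θ * c * c)⁻¹ := inv_nonneg.mpr (by linarith)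
  have hc : 0 ≤ c ∨ IsEmpty g.Site := by
    by_cases hne : Nonempty g.Site
    · exact Or.inl (hrow.nonneg hne.some)
    · exact Or.inr (not_nonempty_iff.mp hne)
  rcases hc with hc | hemp
  swap
  · intro y' μ hμ y
    exact (hemp.false y).elim
  have hK0 : 0 ≤ B₂ + B₂ * (θ * (B₂ * (1 - B₂ * θ * c * c)⁻¹) * c) * c :=
    add_nonneg hB₂ (mul_nonneg (mul_nonneg hB₂ (mul_nonneg (mul_nonneg hθ (mul_nonneg hB₂ hq1)) hc)) hc)
  have hl0' : BlockBd (g := toB6 g R₀ H₀) 𝔬.blk 𝔬.blk (𝔬.G0 U ∘ₗ LinearMap.id)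
      (fun (y y' : g.Site) => ((g.len y)⁻¹)⁻¹ * g.len y' * (B₂ * Real.exp (-(δ₁ * (toB6 g R₀ H₀).dist y y')))) := by
    rw [LinearMap.comp_id]
    exact hL.l0.mono fun y y' => le_of_eq (by simp only [inv_inv, toB6_dist]; ring)
  have hl3' : BlockBd (g := toB6 g R₀ H₀) 𝔬.blk 𝔬.blk (Lap U ∘ₗ 𝔬.G0 U ∘ₗ LinearMap.id)
      (fun (y y' : g.Site) => (g.len y)⁻¹ * g.len y' * (B₂ * Real.exp (-(δ₁ * (toB6 g R₀ H₀).dist y y')))) := by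
    rw [LinearMap.comp_id]
    exact hL.l3.mono fun y y' => le_of_eq (by simp only [toB6_dist]; ring)
  have h := thm312_entry_l2 (g := toB6 g R₀ H₀) (blk₀ := 𝔬.blk) (blk := 𝔬.blk) (blk₃ := 𝔬.blk)
    (W₀ := fun y => g.len y) (W₁ := fun y => g.len y) (W₂ := fun y => (g.len y)⁻¹) (W₁' := fun y => g.len y)
    (W₃ := fun y => g.len y) (G := A) (G0 := 𝔬.G0 U) (T' := T) (Eop := Lap U) (Fop := LinearMap.id)
    (B := B₂) (θ := θ) (A := B₂) (θ' := θ) (BE := B₂) (AEF := B₂) hWl hWl hWi hWl hWl htri hG.dnn hrow hB₂ hθ hB₂ hθ hB₂ hB₂ hρ hσ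
    hρδ
    (hL.l0.mono fun y y' => le_of_eq (by simp only [inv_inv, toB6_dist]; ring))
    (hT.mono fun y y' => le_of_eq (by simp only [toB6_dist]; ring))
    hl0'
    (hT.mono fun y y' => le_of_eq (by simp only [toB6_dist]; ring))
    (hL.l3.mono fun y y' => le_of_eq (by simp only [toB6_dist]; ring))
    hl3' (fix_mul_of_fix hfix) hq
  rw [LinearMap.comp_id] at h
  have h' : BlockBd (g := toB6 g R₀ H₀) 𝔬.blk 𝔬.blk (Lap U ∘ₗ A)
      (fun (y y' : g.Site) => (B₂ + B₂ * (θ * (B₂ * (1 - B₂ * θ * c * c)⁻¹) * c) * c) *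
        (g.len y' ^ (1 : ℝ) * (g.len y ^ (1 : ℝ))⁻¹) * Real.exp (-(ρ * g.dist y y'))) :=
    h.mono fun y y' => le_of_eq (by simp only [toB6_dist, Real.rpow_one]; ring)
  exact blockBd_transfer (C := fun _ _ => B₂ + B₂ * (θ * (B₂ * (1 - B₂ * θ * c * c)⁻¹) * c) * c) (fun _ _ => hK0)
    (fun z => Real.rpow_pos_of_pos (hG.lenpos z) 1) hST h'

/-- ★ **(3.46)₅ FOR A ∈ {G, G₁} AS A BLOCK-L² BOUND** — ‖1_{Δ(y)}AΔ_Uμ‖₂ ≦ K₅e^{−ρ′d}‖μ‖₂: `thm312_entry_l2` with the left letter I and the right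
letter Δ_U in the classes W₀ = (Lʲη)⁻¹, W₁ = W₁′ = Lʲη, W₂ = W₃ = (Lʲη)⁻¹ (from (3.46)₀,₅ for G₀ and the step), which yields the bound with
the ratio Lʲη∕L^{j′}η, then the scale transfer at γ = −1 (constant Λ′): K₅ = (B₂ + B₂θB₂(1 − B₂θc²)⁻¹c²)·Λ′ at the rate ρ − αρ₀.
[cite: Balaban1985BackgroundPropagators, Thm 3.12 p.423 + (3.46) p.398 + (3.130) p.421 + p.398; Balaban1984PropagatorsII, Lemma 2.1 p.234] -/
theorem l2bd_entry5_of_step (hG : GeoOK g) {𝔬 : Ops g B X Y Z W} {Lap : B.Cfg → Module.End ℝ (X → ℝ)} {U : B.Cfg}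
    {T A : Module.End ℝ (X → ℝ)} {B₂ θ δ₁ ρ ρ₀ α Λ σ c : ℝ} (hrow : RowSum (toB6 g R₀ H₀) σ c)
    (hB₂ : 0 ≤ B₂) (hθ : 0 ≤ θ) (hρ : 0 ≤ ρ) (hσ : 0 ≤ σ) (hρδ : ρ + 2 * σ ≤ δ₁)
    (hST : ScaleTransfer g ρ₀ α Λ (fun y => g.len y ^ (-1 : ℝ)))
    (hL : Thm33G0L2 𝔬 Lap R₀ H₀ B₂ δ₁ U)
    (hT : BlockBd (g := toB6 g R₀ H₀) 𝔬.blk 𝔬.blk T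
      (fun (y y' : g.Site) => θ * (g.len y)⁻¹ * (g.len y')⁻¹ * Real.exp (-(δ₁ * g.dist y y'))))
    (hfix : A = 𝔬.G0 U + 𝔬.G0 U ∘ₗ T ∘ₗ A) (hq : B₂ * θ * c * c < 1) :
    BlockBd (g := toB6 g R₀ H₀) 𝔬.blk 𝔬.blk (A ∘ₗ Lap U)
      (fun (y y' : g.Site) => (B₂ + B₂ * (θ * (B₂ * (1 - B₂ * θ * c * c)⁻¹) * c) * c) * Λ *
        Real.exp (-((ρ - α * ρ₀) * g.dist y y'))) := by
  have htri : Triangle254 (toB6 g R₀ H₀) := fun a b c => hG.tri a b c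
  have hWl : ∀ y : g.Site, 0 < g.len y := hG.lenpos
  have hWi : ∀ y : g.Site, 0 < (g.len y)⁻¹ := fun y => inv_pos.mpr (hG.lenpos y)
  have hne : ∀ y : g.Site, g.len y ≠ 0 := fun y => (hG.lenpos y).ne'
  have hq1 : 0 ≤ (1 - B₂ * θ * c * c)⁻¹ := inv_nonneg.mpr (by linarith)
  have hc : 0 ≤ c ∨ IsEmpty g.Site := by
    by_cases hne' : Nonempty g.Site
    · exact Or.inl (hrow.nonneg hne'.some)
    · exact Or.inr (not_nonempty_iff.mp hne')
  rcases hc with hc | hemp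
  swap
  · intro y' μ hμ y
    exact (hemp.false y).elim
  have hK0 : 0 ≤ B₂ + B₂ * (θ * (B₂ * (1 - B₂ * θ * c * c)⁻¹) * c) * c :=
    add_nonneg hB₂ (mul_nonneg (mul_nonneg hB₂ (mul_nonneg (mul_nonneg hθ (mul_nonneg hB₂ hq1)) hc)) hc)
  have hE' : BlockBd (g := toB6 g R₀ H₀) 𝔬.blk 𝔬.blk (LinearMap.id ∘ₗ 𝔬.G0 U)
      (fun (y y' : g.Site) => ((g.len y)⁻¹)⁻¹ * g.len y' * (B₂ * Real.exp (-(δ₁ * (toB6 g R₀ H₀).dist y y')))) := by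
    rw [LinearMap.id_comp]
    exact hL.l0.mono fun y y' => le_of_eq (by simp only [inv_inv, toB6_dist]; ring)
  have hEF' : BlockBd (g := toB6 g R₀ H₀) 𝔬.blk 𝔬.blk (LinearMap.id ∘ₗ 𝔬.G0 U ∘ₗ Lap U)
      (fun (y y' : g.Site) => ((g.len y)⁻¹)⁻¹ * (g.len y')⁻¹ * (B₂ * Real.exp (-(δ₁ * (toB6 g R₀ H₀).dist y y')))) := by
    rw [LinearMap.id_comp]
    exact hL.l5.mono fun y y' => le_of_eq (by simp only [inv_inv, toB6_dist]; ring)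
  have h := thm312_entry_l2 (g := toB6 g R₀ H₀) (blk₀ := 𝔬.blk) (blk := 𝔬.blk) (blk₃ := 𝔬.blk)
    (W₀ := fun y => (g.len y)⁻¹) (W₁ := fun y => g.len y) (W₂ := fun y => (g.len y)⁻¹) (W₁' := fun y => g.len y)
    (W₃ := fun y => (g.len y)⁻¹) (G := A) (G0 := 𝔬.G0 U) (T' := T) (Eop := LinearMap.id) (Fop := Lap U)
    (B := B₂) (θ := θ) (A := B₂) (θ' := θ) (BE := B₂) (AEF := B₂) hWi hWl hWi hWl hWi htri hG.dnn hrow hB₂ hθ hB₂ hθ hB₂ hB₂ hρ hσ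
    hρδ
    (hL.l0.mono fun y y' => le_of_eq (by simp only [inv_inv, toB6_dist]; ring))
    (hT.mono fun y y' => le_of_eq (by simp only [toB6_dist]; ring))
    (hL.l5.mono fun y y' => le_of_eq (by simp only [inv_inv, toB6_dist]; ring))
    (hT.mono fun y y' => le_of_eq (by simp only [toB6_dist]; ring))
    hE' hEF' (fix_mul_of_fix hfix) hq
  rw [LinearMap.id_comp] at h
  have h' : BlockBd (g := toB6 g R₀ H₀) 𝔬.blk 𝔬.blk (A ∘ₗ Lap U)
      (fun (y y' : g.Site) => (B₂ + B₂ * (θ * (B₂ * (1 - B₂ * θ * c * c)⁻¹) * c) * c) *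
        (g.len y' ^ (-1 : ℝ) * (g.len y ^ (-1 : ℝ))⁻¹) * Real.exp (-(ρ * g.dist y y'))) := by
    refine h.mono fun y y' => le_of_eq ?_
    simp only [toB6_dist, Real.rpow_neg_one, inv_inv]
    ring
  exact blockBd_transfer (C := fun _ _ => B₂ + B₂ * (θ * (B₂ * (1 - B₂ * θ * c * c)⁻¹) * c) * c) (fun _ _ => hK0)
    (fun z => Real.rpow_pos_of_pos (hG.lenpos z) (-1)) hST h'

end L2Classes

end

end Literature.MathematicalPhysics.QuantumFieldTheory.Balaban1983to89.B9Thm312WholeL2
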